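import Summits.QuantumAdvantage.QuantumAdvantage.Theorems.CubicForrelationNearExactIsExactTwelveLevelFiveGenericAt2932
import Summits.QuantumAdvantage.QuantumAdvantage.Theorems.CubicForrelationNearExactIsExactTwelveLevelFiveRoundOneGe2932
import Summits.QuantumAdvantage.QuantumAdvantage.Theorems.CubicForrelationNearExactIsExactTwelveTypeO768DeadAt2932
import Summits.QuantumAdvantage.QuantumAdvantage.Theorems.CubicForrelationNearExactIsExactTwelveTypeO896At2932

/-!
# Crux `CubicForrelation.NearExactIsExact` (stmt-QuantumAdvantage-14043) — n = 12 AT `Φ = 29/32`: a GENERIC level-5 side is DEAD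
  (its partner would be a type-O side of base `768` or `896`, both dead)

Certificate seat `b2b-cforr-cert` (gen 22).  HONEST FRAMING: a kernel-checked corollary (standard axioms, no `decide`) for the boundary rung
`29/32` at `n = 12` (HOME/b2b-cforr-cert-g22/PLAN-N12-928-EQ.md): `tw22_levelFive_generic_partner_base` (partner type O with base `768` or
`896`) combined with `to22_typeO_E768_ge2932_false` and `to22_typeO_E896_ge2932_false`.  So at `Φ = 29/32` a level-5 side (`W_g = 32u'`, some
`u'` odd) must be RIGID: either the pair is NOT exact off the odd hyperplane (off-hyperplane energy exactly `1024`), or round 1 of the cascade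
fails (the `128`-point configuration of `tw22_levelFive_ge2932_round1`).  NO new value of `θ₁₂`.  NOT summit progress.

References: J. Ax (1964) / R. J. McEliece (1972); Kasami–Tokura (1970); MacWilliams–Sloane (1977) Ch. 13–15.  Axioms: the standard three.
-/

set_option linter.dupNamespace false -- D-0017: single-problem summit ⇒ `QuantumAdvantage.QuantumAdvantage` by design

noncomputable section

namespace Summit.QuantumAdvantage.QuantumAdvantage.Theorems.CubicForrelation.NearExactIsExact

open Finset
open Literature.Computability.QuantumComplexity
open Literature.Computability.QuantumComplexity.BuzetChailloux (zeroVec)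
open Literature.Computability.QuantumComplexity.DerivativeWalsh (W)

/-- **A generic level-5 side is dead at `Φ ≥ 29/32`** (12 bits): cubic `f, g`, `W_g = 32u'` with some `u'` odd, the pair exact off the odd
hyperplane and round 1 passed (`8 ∣ u' − 2(−1)^f − (−1)^D`, `D` quadratic): impossible.  NOT summit progress. [this work] -/
theorem tw22_levelFive_generic_false (f g : (Fin (6 + 6) → Bool) → Bool) (hf : IsDegLeFun 3 f) (hg : IsDegLeFun 3 g)
    (u' : (Fin (6 + 6) → Bool) → ℤ) (hu' : ∀ x, W (fun y => signOf (g y)) x = (2 : ℝ) ^ 5 * (u' x : ℝ))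
    (hodd : ∃ x, Odd (u' x)) (hΦ : (29 / 32 : ℝ) ≤ forrelation f g)
    (hoff : ∀ y, ¬ Odd (u' y) → u' y = 2 * sZ (f y))
    (D : (Fin (6 + 6) → Bool) → Bool) (hD : IsDegLeFun 2 D) (h8 : ∀ x, Odd (u' x) → (8 : ℤ) ∣ u' x - 2 * sZ (f x) - sZ (D x)) :
    False := by
  have hΦ' : forrelation g f = forrelation f g := by
    rw [Summit.QuantumAdvantage.QuantumAdvantage.Theorems.SignedCubicForrelationNotPrBPP.Negative.HalfQuad.forrelation_comm]
  have hlo' : (29 / 32 : ℝ) ≤ forrelation g f := by rw [hΦ']; exact hΦ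
  obtain ⟨uf, huf, hO, hbase⟩ := tw22_levelFive_generic_partner_base f g hf hg u' hu' hodd hΦ hoff D hD h8
  obtain ⟨x₀, -⟩ := hodd
  rcases hbase with h768 | h896
  · exact to22_typeO_E768_ge2932_false g f hg hf uf huf ⟨x₀, hO x₀⟩ h768 hlo'
  · exact to22_typeO_E896_ge2932_false g f hg hf uf huf ⟨x₀, hO x₀⟩ h896 hlo'

/-- **At `Φ ≥ 29/32` a level-5 side that is exact off its odd hyperplane is in the rigid round-1 configuration** (packaging of
`tw22_levelFive_ge2932_round1` with `tw22_levelFive_generic_false`).  NOT summit progress. [this work] -/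
theorem tw22_levelFive_ge2932_rigid (f g : (Fin (6 + 6) → Bool) → Bool) (hf : IsDegLeFun 3 f) (hg : IsDegLeFun 3 g)
    (u' : (Fin (6 + 6) → Bool) → ℤ) (hu' : ∀ x, W (fun y => signOf (g y)) x = (2 : ℝ) ^ 5 * (u' x : ℝ))
    (hodd : ∃ x, Odd (u' x)) (hΦ : (29 / 32 : ℝ) ≤ forrelation f g)
    (hoff : ∀ y, ¬ Odd (u' y) → u' y = 2 * sZ (f y)) :
    ∃ (γ : Fin (6 + 6) → Bool) (tg : ℝ) (D : (Fin (6 + 6) → Bool) → Bool),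
      (tg = 1 ∨ tg = -1) ∧ γ ≠ zeroVec ∧ (∀ x, (Odd (u' x) ↔ twist γ x = tg)) ∧ IsDegLeFun 2 D ∧
      (∀ x, Odd (u' x) → (u' x - 2 * sZ (f x) = sZ (D x) ∨ u' x - 2 * sZ (f x) = -3 * sZ (D x))) ∧
      #(univ.filter fun x : Fin (6 + 6) → Bool => Odd (u' x) ∧ u' x - 2 * sZ (f x) = -3 * sZ (D x)) = 128 ∧
      forrelation f g = 29 / 32 := by
  rcases tw22_levelFive_ge2932_round1 f g hf hg u' hu' hodd hΦ hoff with h | ⟨γ, tg, D, -, -, -, hD, h8⟩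
  · exact h
  · exact (tw22_levelFive_generic_false f g hf hg u' hu' hodd hΦ hoff D hD h8).elim

end Summit.QuantumAdvantage.QuantumAdvantage.Theorems.CubicForrelation.NearExactIsExact

end
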